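import Literature.AlgebraicGeometry.HodgeTheory.CyclicCoverScalingCoordinates
import HarnessLib

/-!
# The monodromy of the scaling loop of the Carlson–Toledo family is `(σ_F⁻¹)^*`

Family `hodge`, layer `Literature/AlgebraicGeometry/HodgeTheory`. Third file of the proof that the covering
transformation of `X_F : x₃^p = f` is a monodromy transformation (seat `hodge-nonav-prover-Ax` g7, crux K1 of route
`CyclicUnitaryPowers`, stmt-HodgeConjecture-19544). On the one-parameter scaling family `λ ↦ X_{x₃^p − λ f}`
(`scalingFamily p f`, file `CyclicCoverScalingFamily`):

* the two half-turns `loopHalf₁` (`λ = e^{πiu}`, from `λ = 1` to `λ = −1`) and `loopHalf₂` (`λ = −e^{πiu}`, back to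
  `λ = 1`) run inside the slit regions `{−iλ ∈ ℂ ∖ (−∞,0]}` resp. `{iλ ∈ ℂ ∖ (−∞,0]}` of the base
  (`neg_I_mul_halfTurn_zero_mem`, `I_mul_halfTurn_one_mem`), over which the untwisting maps `Θ₁, Θ₂`
  (`CyclicCoverScalingCoordinates.untwist`) trivialise the family topologically;
* **`transportFun_scalingLoop`** — for an identification `e : 𝒴_{λ=1} ≅ X_F` compatible with the embeddings into
  `ℙ³`, parallel transport in `R^k u_* ℂ` along the scaling loop (`scalingLoopClass = ⟦loopHalf₁⟧·⟦loopHalf₂⟧`)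
  satisfies `γ_* (e^* α) = e^* ((σ_F⁻¹)^* α)`, `σ_F⁻¹ = diagonalAut (deckUnit p)⁻¹ : x₃ ↦ ζ_p⁻¹ x₃`: along
  each half the transported classes are restrictions of the tube class `Θ_j^* α` (`transportFun_fiberRestrict`), the
  two tube classes agree on the fibre `λ = −1` (`c₁(−1) = c₂(−1)`), `Θ₁ = e` on the fibre `λ = 1` (`c₁(1) = 1`)
  and `Θ₂ = σ_F⁻¹ ∘ e` there (`c₂(1) = ζ_p⁻¹`).

Theorems and concrete definitions (paths) only; no named fact.

## References

* [CarlsonToledo1999] J. A. Carlson, D. Toledo, Discriminant complements and kernels of monodromy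
  representations, Duke Math. J. 97 (1999), §2 (held text p0004–p0005).
* [VoisinHodgeII2003] C. Voisin, Hodge Theory and Complex Algebraic Geometry II, CUP 2003, §3.1.2, §3.2.1.
* [SerreGAGA1956] J.-P. Serre, GAGA, §2 n°5.
-/

noncomputable section

namespace Literature.AlgebraicGeometry.HodgeTheory

open CategoryTheory MvPolynomial
open _root_.Topology
open Literature.AlgebraicGeometry.Motives Literature.AlgebraicGeometry.Motives.UniversalHypersurface
open Literature.AlgebraicGeometry.HodgeTheory.UniversalHypersurface
open Literature.AlgebraicTopology.SingularHomology
open Literature.NumberTheory.Transcendental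
open scoped LinearAlgebra.Projectivization

namespace CyclicCoverScaling

/-! ### §3 The monodromy of the scaling loop is `(σ_F⁻¹)^*` -/

section Monodromy

variable {p : ℕ} [NeZero p] {f : MvPolynomial (Fin 3) ℂ}

/-- `e^{iθ}` lies in the slit plane for `θ ∈ [−π/2, π/2]`. [folklore] -/
private theorem exp_mul_I_mem_slitPlane {θ : ℝ} (h₁ : -(Real.pi / 2) ≤ θ) (h₂ : θ ≤ Real.pi / 2) :
    Complex.exp ((θ : ℂ) * Complex.I) ∈ Complex.slitPlane := by
  rw [Complex.mem_slitPlane_iff_arg, Complex.exp_mul_I, Complex.arg_cos_add_sin_mul_I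
    ⟨by linarith [Real.pi_pos], by linarith [Real.pi_pos]⟩]
  refine ⟨by linarith [Real.pi_pos], fun h => ?_⟩
  have := congrArg Complex.normSq h
  rw [← Complex.exp_mul_I, Complex.normSq_eq_norm_sq, Complex.norm_exp_ofReal_mul_I, map_zero] at this
  norm_num at this

/-- The points of the first half-turn lie in the first slit region: `−i·e^{πiu} = e^{πi(u − 1/2)}`.
[cite: VoisinHodgeII2003, §3.2.1] -/
theorem neg_I_mul_halfTurn_zero_mem (u : unitInterval) : -Complex.I * halfTurn 0 u ∈ Complex.slitPlane := by
  have h : -Complex.I * halfTurn 0 u = Complex.exp (((Real.pi * ((u : ℝ) - 1 / 2) : ℝ) : ℂ) * Complex.I) := by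
    rw [halfTurn, show -Complex.I = Complex.exp (-(Real.pi / 2 : ℂ) * Complex.I) by
      rw [neg_mul, Complex.exp_neg, Complex.exp_pi_div_two_mul_I, Complex.inv_I], ← Complex.exp_add]
    congr 1; push_cast; ring
  rw [h]
  have hu0 := u.2.1; have hu1 := u.2.2
  exact exp_mul_I_mem_slitPlane (by nlinarith [Real.pi_pos]) (by nlinarith [Real.pi_pos])

/-- The points of the second half-turn lie in the second slit region: `i·e^{πi(1+u)} = e^{πi(u − 1/2)}`.
[cite: VoisinHodgeII2003, §3.2.1] -/
theorem I_mul_halfTurn_one_mem (u : unitInterval) : Complex.I * halfTurn 1 u ∈ Complex.slitPlane := by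
  have hsum : (Real.pi / 2 : ℂ) * Complex.I + (Real.pi : ℂ) * Complex.I * ((1 : ℝ) + ((u : ℝ) : ℂ)) =
      (((Real.pi * ((u : ℝ) - 1 / 2) : ℝ) : ℂ) * Complex.I) + 2 * Real.pi * Complex.I := by
    push_cast; ring
  have h : Complex.I * halfTurn 1 u = Complex.exp (((Real.pi * ((u : ℝ) - 1 / 2) : ℝ) : ℂ) * Complex.I) := by
    calc Complex.I * halfTurn 1 u
        = Complex.exp ((Real.pi / 2 : ℂ) * Complex.I) *
            Complex.exp ((Real.pi : ℂ) * Complex.I * ((1 : ℝ) + ((u : ℝ) : ℂ))) := by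
          rw [Complex.exp_pi_div_two_mul_I]; rfl
      _ = Complex.exp (((Real.pi * ((u : ℝ) - 1 / 2) : ℝ) : ℂ) * Complex.I) := by
          rw [← Complex.exp_add, hsum, Complex.exp_add, Complex.exp_two_pi_mul_I, mul_one]
  rw [h]
  have hu0 := u.2.1; have hu1 := u.2.2
  exact exp_mul_I_mem_slitPlane (by nlinarith [Real.pi_pos]) (by nlinarith [Real.pi_pos])

/-- The untwisting map as a continuous map of the tube. [cite: SerreGAGA1956, §2 n°5] -/
def untwistC (hf : f.IsHomogeneous p) (hf0 : f ≠ 0) (ε : ℂ) (θ : ℝ)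
    (hε : Complex.exp ((θ : ℂ) * Complex.I) * ε = 1) :
    C(tubeOver (scalingFamily p f) {t | ε * baseCoord p f t ∈ Complex.slitPlane},
      ComplexPoints (SmoothHypersurface.hypersurface (cyclicCoverForm p f))) :=
  ⟨untwist hf ε θ hε, continuous_untwist hf hf0 ε θ hε⟩

omit [NeZero p] in
/-- Two continuous maps into `X_F(ℂ)` with the same homogeneous coordinates are equal. [cite: SerreGAGA1956, §2 n°5] -/
theorem continuousMap_eq_of_hypersurfacePoint_eq {Z : Type*} [TopologicalSpace Z]
    {g h : C(Z, ComplexPoints (SmoothHypersurface.hypersurface (cyclicCoverForm p f)))}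
    (H : ∀ z, hypersurfacePoint (SmoothHypersurface.hypersurfaceι (cyclicCoverForm p f)) (g z) =
      hypersurfacePoint (SmoothHypersurface.hypersurfaceι (cyclicCoverForm p f)) (h z)) : g = h := by
  haveI := SmoothHypersurface.isClosedImmersion_hypersurfaceι_left (cyclicCoverForm p f)
  exact ContinuousMap.ext fun z =>
    (isEmbedding_hypersurfacePoint (SmoothHypersurface.hypersurfaceι (cyclicCoverForm p f))).injective (H z)

/-- **On a fibre, the untwisting map is determined by `λ` only**: for `t` in the slit region and `y'` in the fibre
over `t`, the untwisted point has coordinates `[x₀:x₁:x₂:c(λ(t))x₃]`. [cite: CarlsonToledo1999, §2 (held text p0004)] -/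
theorem hypersurfacePoint_untwistC_fiberToTube (hf : f.IsHomogeneous p) (hf0 : f ≠ 0) (ε : ℂ) (θ : ℝ)
    (hε : Complex.exp ((θ : ℂ) * Complex.I) * ε = 1) {t : ComplexPoints (scalingBase p f)}
    (ht : t ∈ {t | ε * baseCoord p f t ∈ Complex.slitPlane}) (y' : ComplexPoints (fiberOver (scalingFamily p f) t)) :
    hypersurfacePoint (SmoothHypersurface.hypersurfaceι (cyclicCoverForm p f))
        ((untwistC hf hf0 ε θ hε).comp (fiberToTube (scalingFamily p f) ht) y') =
      unitScale (lastUnit (Units.mk0 (branchRoot p ε θ (baseCoord p f t)) (branchRoot_ne_zero _ _ _ _)))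
        (totalProj p f (AlgPoints.map (fiberι (scalingFamily p f) t) y')) := by
  change hypersurfacePoint _ (untwist hf ε θ hε (fiberToTube (scalingFamily p f) ht y')) = _
  rw [hypersurfacePoint_untwist]
  have hpt : AlgPoints.map (scalingFamily p f) (fiberToTube (scalingFamily p f) ht y').1 = t :=
    AlgPoints.map_map_fiberι _ _ _
  simp only [hpt]
  rfl

variable (hp : 2 ≤ p) (hf : f.IsHomogeneous p) (hf0 : f ≠ 0)
  (hJ : SmoothHypersurface.IsNonsingularForm ℂ (cyclicCoverForm p f))

/-- The base point `λ = 1`. [cite: CarlsonToledo1999, §2 (held text p0004)] -/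
abbrev basePt : ComplexPoints (scalingBase p f) := scalingPoint p f hp hf hJ 1 one_ne_zero

/-- The midpoint `λ = −1`. [cite: CarlsonToledo1999, §2 (held text p0004)] -/
abbrev midPt : ComplexPoints (scalingBase p f) := scalingPoint p f hp hf hJ (-1) (neg_ne_zero.mpr one_ne_zero)

omit [NeZero p] in
/-- Points with equal parameters are equal (proof irrelevance of the non-vanishing witness). [cite: VoisinHodgeII2003, §3.1.2] -/
theorem scalingPoint_congr {c c' : ℂ} (h : c = c') (hc : c ≠ 0) (hc' : c' ≠ 0) :
    scalingPoint p f hp hf hJ c hc = scalingPoint p f hp hf hJ c' hc' := by subst h; rfl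

/-- The first half of the scaling loop, `λ = e^{πiu}`, from `λ = 1` to `λ = −1`, in the subspace `Set.univ`.
[cite: CarlsonToledo1999, §2 (held text p0004)] -/
def loopHalf₁ : Path (⟨basePt hp hf hJ, Set.mem_univ _⟩ : (Set.univ : Set (ComplexPoints (scalingBase p f))))
    ⟨midPt hp hf hJ, Set.mem_univ _⟩ :=
  (((scalingArc hp hf hf0 hJ 0).cast
      (scalingPoint_congr hp hf hJ halfTurn_zero_zero.symm _ _)
      (scalingPoint_congr hp hf hJ (by rw [halfTurn_zero_one]; simp [halfTurn]) _ _)).map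
    (continuous_id.subtype_mk fun x => Set.mem_univ x))

/-- The second half of the scaling loop, `λ = e^{πi(1+u)}`, from `λ = −1` back to `λ = 1`.
[cite: CarlsonToledo1999, §2 (held text p0004)] -/
def loopHalf₂ : Path (⟨midPt hp hf hJ, Set.mem_univ _⟩ : (Set.univ : Set (ComplexPoints (scalingBase p f))))
    ⟨basePt hp hf hJ, Set.mem_univ _⟩ :=
  (((scalingArc hp hf hf0 hJ 1).cast
      (scalingPoint_congr hp hf hJ (by simp [halfTurn]) _ _)
      (scalingPoint_congr hp hf hJ halfTurn_one_one.symm _ _)).map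
    (continuous_id.subtype_mk fun x => Set.mem_univ x))

omit [NeZero p] in
/-- `loopHalf₁ u` is the point `λ = e^{πiu}`. [cite: CarlsonToledo1999, §2 (held text p0004)] -/
theorem loopHalf₁_apply (u : unitInterval) :
    (loopHalf₁ hp hf hf0 hJ u).1 = scalingPoint p f hp hf hJ (halfTurn 0 u) (halfTurn_ne_zero 0 u) := rfl

omit [NeZero p] in
/-- `loopHalf₂ u` is the point `λ = −e^{πiu}`. [cite: CarlsonToledo1999, §2 (held text p0004)] -/
theorem loopHalf₂_apply (u : unitInterval) :
    (loopHalf₂ hp hf hf0 hJ u).1 = scalingPoint p f hp hf hJ (halfTurn 1 u) (halfTurn_ne_zero 1 u) := rfl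

/-- **The scaling loop** `u ↦ (λ = e^{2πiu})` at `λ = 1`, as the concatenation of its two halves (homotopy class).
[cite: CarlsonToledo1999, §2 (held text p0004)] -/
def scalingLoopClass : Path.Homotopic.Quotient
    (⟨basePt hp hf hJ, Set.mem_univ _⟩ : (Set.univ : Set (ComplexPoints (scalingBase p f))))
    ⟨basePt hp hf hJ, Set.mem_univ _⟩ :=
  Path.Homotopic.Quotient.trans ⟦loopHalf₁ hp hf hf0 hJ⟧ ⟦loopHalf₂ hp hf hf0 hJ⟧

/-- **The monodromy of the scaling loop on `H²` with complex coefficients.** For a fibre identification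
`e : 𝒴_{λ=1} ≅ X_F` compatible with the embeddings into `ℙ³`, transport along the scaling loop takes `e^{-1 *} α`
hmm precisely: `γ_* ((e.hom)^* α) = (e.hom)^* ((σ_F⁻¹)^* α)` for every `α ∈ H²(X_F(ℂ); ℂ)`, `σ_F⁻¹ = diagonalAut (deckUnit p)⁻¹`
(`x₃ ↦ ζ_p⁻¹ x₃`): over the first half-turn the classes are restrictions of the tube class `Θ₁^* α`, over the second
of `Θ₂^* α` (`transportFun_fiberRestrict`), the two tube classes agree on the fibre `λ = −1`, and on the fibre `λ = 1`
the untwisting maps are `e` resp. `σ_F⁻¹ ∘ e`. [cite: CarlsonToledo1999, §2 (universalcyclic) (held text p0004–p0005)]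
[cite: VoisinHodgeII2003, §3.1.2] -/
theorem transportFun_scalingLoop (k : ℕ)
    (e : fiberOver (scalingFamily p f) (basePt hp hf hJ) ≅ SmoothHypersurface.hypersurface (cyclicCoverForm p f))
    (he : e.hom ≫ SmoothHypersurface.hypersurfaceι (cyclicCoverForm p f) =
      fiberι (scalingFamily p f) (basePt hp hf hJ) ≫ totalToProjectiveSpace p f)
    (α : complexBetti (SmoothHypersurface.hypersurface (cyclicCoverForm p f)) k) :
    transportFun (scalingFamily p f) k (scalingFamily_locallyTrivial p f) (scalingLoopClass hp hf hf0 hJ)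
        (complexBetti.map e.hom k α) =
      complexBetti.map e.hom k (complexBetti.map (diagonalAut (cyclicCoverForm p f)
        (inv_mem (deckUnit_mem_diagonalStabilizer (NeZero.ne p) f))) k α) := by
  -- the two slit regions and their untwisting maps
  set B₁ : Set (ComplexPoints (scalingBase p f)) := {t | -Complex.I * baseCoord p f t ∈ Complex.slitPlane} with hB₁
  set B₂ : Set (ComplexPoints (scalingBase p f)) := {t | Complex.I * baseCoord p f t ∈ Complex.slitPlane} with hB₂
  have hB₁o : IsOpen B₁ := Complex.isOpen_slitPlane.preimage
    (continuous_const.mul (continuous_baseCoord (NeZero.ne p) hf hf0))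
  have hB₂o : IsOpen B₂ := Complex.isOpen_slitPlane.preimage
    (continuous_const.mul (continuous_baseCoord (NeZero.ne p) hf hf0))
  have hbc : ∀ (c : ℂ) (hc : c ≠ 0), baseCoord p f (scalingPoint p f hp hf hJ c hc) = c :=
    fun c hc => baseCoord_scalingPoint hp hf hJ c hc
  have hℓ₁ : ∀ u, (loopHalf₁ hp hf hf0 hJ u).1 ∈ B₁ := fun u => by
    change -Complex.I * baseCoord p f (loopHalf₁ hp hf hf0 hJ u).1 ∈ Complex.slitPlane
    rw [loopHalf₁_apply, hbc]; exact neg_I_mul_halfTurn_zero_mem u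
  have hℓ₂ : ∀ u, (loopHalf₂ hp hf hf0 hJ u).1 ∈ B₂ := fun u => by
    change Complex.I * baseCoord p f (loopHalf₂ hp hf hf0 hJ u).1 ∈ Complex.slitPlane
    rw [loopHalf₂_apply, hbc]; exact I_mul_halfTurn_one_mem u
  have hs₁ : basePt hp hf hJ ∈ B₁ := by
    change -Complex.I * baseCoord p f _ ∈ Complex.slitPlane
    rw [hbc, mul_one]; exact Complex.mem_slitPlane_iff.mpr (Or.inr (by simp))
  have hm₁ : midPt hp hf hJ ∈ B₁ := by
    change -Complex.I * baseCoord p f _ ∈ Complex.slitPlane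
    rw [hbc, mul_neg_one, neg_neg]; exact Complex.mem_slitPlane_iff.mpr (Or.inr (by simp))
  have hm₂ : midPt hp hf hJ ∈ B₂ := by
    change Complex.I * baseCoord p f _ ∈ Complex.slitPlane
    rw [hbc, mul_neg_one]; exact Complex.mem_slitPlane_iff.mpr (Or.inr (by simp))
  have hs₂ : basePt hp hf hJ ∈ B₂ := by
    change Complex.I * baseCoord p f _ ∈ Complex.slitPlane
    rw [hbc, mul_one]; exact Complex.mem_slitPlane_iff.mpr (Or.inr (by simp))
  set Θ₁ := untwistC hf hf0 (-Complex.I) (Real.pi / 2) exp_mul_neg_I with hΘ₁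
  set Θ₂ := untwistC hf hf0 Complex.I (3 * Real.pi / 2) exp_mul_I with hΘ₂
  set ξ₁ : singularCohomology ℂ ℂ (tubeOver (scalingFamily p f) B₁) k := singularCohomology.map ℂ ℂ Θ₁ k α
  set ξ₂ : singularCohomology ℂ ℂ (tubeOver (scalingFamily p f) B₂) k := singularCohomology.map ℂ ℂ Θ₂ k α
  -- restriction of `ξ_j` to a fibre = pull-back along `Θ_j ∘ (fibre inclusion)`
  have hres : ∀ (B : Set (ComplexPoints (scalingBase p f))) (Θ : C(tubeOver (scalingFamily p f) B,
      ComplexPoints (SmoothHypersurface.hypersurface (cyclicCoverForm p f)))) {t} (ht : t ∈ B),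
      fiberRestrict (scalingFamily p f) ht k (singularCohomology.map ℂ ℂ Θ k α) =
        singularCohomology.map ℂ ℂ (Θ.comp (fiberToTube (scalingFamily p f) ht)) k α := fun B Θ t ht => by
    rw [fiberRestrict, singularCohomology.map_comp, ModuleCat.comp_apply]
  -- on the fibre `λ = 1`: `Θ₁ ∘ incl = e`
  have hstart : Θ₁.comp (fiberToTube (scalingFamily p f) hs₁) = AlgPoints.mapContinuous (L := ℂ) e.hom := by
    refine continuousMap_eq_of_hypersurfacePoint_eq fun y' => ?_
    have hu : lastUnit (Units.mk0 (branchRoot p (-Complex.I) (Real.pi / 2) (baseCoord p f (basePt hp hf hJ)))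
        (branchRoot_ne_zero _ _ _ _)) = 1 := by
      rw [← lastUnit_one]; congr 1; ext; rw [Units.val_mk0, hbc, branchRoot_one_fst, Units.val_one]
    rw [hΘ₁, hypersurfacePoint_untwistC_fiberToTube, hu, unitScale_one, totalProj, ← hypersurfacePoint_comp, ← he,
      hypersurfacePoint_comp]
    rfl
  -- on the fibre `λ = −1`: `Θ₁ ∘ incl = Θ₂ ∘ incl`
  have hmid : Θ₁.comp (fiberToTube (scalingFamily p f) hm₁) = Θ₂.comp (fiberToTube (scalingFamily p f) hm₂) := by
    refine continuousMap_eq_of_hypersurfacePoint_eq fun y' => ?_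
    rw [hΘ₁, hΘ₂, hypersurfacePoint_untwistC_fiberToTube, hypersurfacePoint_untwistC_fiberToTube, hbc]
    simp only [branchRoot_neg_one]
  -- on the fibre `λ = 1` reached along the second branch: `Θ₂ ∘ incl = σ_F⁻¹ ∘ e`
  have hend : Θ₂.comp (fiberToTube (scalingFamily p f) hs₂) =
      (diagonalMap (cyclicCoverForm p f) (inv_mem (deckUnit_mem_diagonalStabilizer (NeZero.ne p) f))).comp
        (AlgPoints.mapContinuous (L := ℂ) e.hom) := by
    refine continuousMap_eq_of_hypersurfacePoint_eq fun y' => ?_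
    rw [hΘ₂, hypersurfacePoint_untwistC_fiberToTube, hbc, ContinuousMap.comp_apply, hypersurfacePoint_diagonalMap]
    have hu : lastUnit (Units.mk0 (branchRoot p Complex.I (3 * Real.pi / 2) 1) (branchRoot_ne_zero _ _ _ _)) =
        (deckUnit p)⁻¹ := by
      rw [deckUnit_inv_eq_lastUnit]; congr 1; ext; rw [Units.val_mk0, Units.val_mk0, branchRoot_one_snd]
    rw [hu, totalProj, ← hypersurfacePoint_comp, ← he, hypersurfacePoint_comp]
    rfl
  -- transport along the two halves
  rw [scalingLoopClass, transportFun_trans]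
  have h1 : complexBetti.map e.hom k α = fiberRestrict (scalingFamily p f) hs₁ k ξ₁ := by
    rw [hres B₁ Θ₁ hs₁, hstart]
  rw [h1, transportFun_fiberRestrict (scalingFamily p f) k (scalingFamily_locallyTrivial p f) hB₁o
    (loopHalf₁ hp hf hf0 hJ) hℓ₁ hs₁ hm₁ ξ₁]
  have h2 : fiberRestrict (scalingFamily p f) hm₁ k ξ₁ = fiberRestrict (scalingFamily p f) hm₂ k ξ₂ := by
    rw [hres B₁ Θ₁ hm₁, hres B₂ Θ₂ hm₂, hmid]
  rw [h2, transportFun_fiberRestrict (scalingFamily p f) k (scalingFamily_locallyTrivial p f) hB₂o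
    (loopHalf₂ hp hf hf0 hJ) hℓ₂ hm₂ hs₂ ξ₂, hres B₂ Θ₂ hs₂, hend, singularCohomology.map_comp,
    ModuleCat.comp_apply]
  rfl

end Monodromy

end CyclicCoverScaling

end Literature.AlgebraicGeometry.HodgeTheory

end
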